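import Summits.QuantumFields.YangMills.Theorems.BalabanUVNodesN11RunGuardOfFlowControl
import Summits.QuantumFields.YangMills.Theorems.BalabanUVNodesN11CompatibleInitialSegmentSplit
import Summits.QuantumFields.YangMills.Theorems.BalabanUVNodesN11Sect3SupplyChainObligationsDefs
import Literature.MathematicalPhysics.QuantumFieldTheory.Balaban1983to89.B16RLeafRecord13SepCoPH

/-!
# DAG node N11 — THE NODE FACE WITH THE CHAIN ASKED ONLY ON COMPATIBLE WINDOW RUNS: `Dag.B14_main (leavesP w p)` at a world bound to the (Sep)CoPH datum of `θ` on the live-selector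
# line, for every run whose TOP 𝐃_K-cube fits the torus (resp. whose last coupling clears the floor), from N11's one-token residual `SupplyChainAt θ p` asked ONLY on runs that lie in
# the window AND are partition-compatible — the run guard `PartCompat₁₃` being PRODUCED INSIDE THE NODE from its own antecedents `smallCouplings` + `flowControl` ((2.6));
# in [I] Thm 2's regime (`g_K = g_R`) the per-run divisibility is ONE world-level scalar `M·R_K(g_R) ∣ 2L^m`

HEADER — WORK-UNIT METADATA.  Cell `pub-ymgap`, YM-PLAN Track A (HUMAN RULING D-0062 ∕ D-0149 width seats), seat `pub-ymgap-dag-n11-w4` (g5; WIDTH SEAT 4 of 4 on NODE n11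
[B14]), route `BalabanUVNodes` rev 29, deciding item K1⁹ `StabilityBRunRowsAtRecordR13SepCoPHV` = stmt-QuantumFields-27364 (helper lane, `--kind proof --supports 27364 --as helper`,
count-neutral).  [III] = [Balaban1988Convergent], [I] = [Balaban1987RG1], [IV] = [Balaban1989LargeFieldI].  Over this seat's `…N11RunGuardOfFlowControl` (the guard from
`smallCouplings` + `flowControl` + top divisibility ∕ floor), dag-n11-e's `…N11Sect3SupplyChainObligationsDefs` (`SupplyChainAt`, `thmP245Laws_of_supplyChainAt`), node00-def-T's
`B16RLeafRecord13SepCoPH` ∕ `…Record13LiveCoPH` (`b14_main_at_record₁₃SepCoPH_of_liveSel`, `b14_main_at_record₁₃CoPH_of_liveSel`-type faces), and dag-n11-d's pattern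
`…N11K1CeilingFreeOfSupplyChain.b14_main_leavesP_of_supplyChainAt_of_window` (the chain asked only on window runs).

WHY THIS FILE.  On the witness-chain road N11's node at a world `w` is supplied from the (θ, P)-keyed token `SupplyChainAt θ P`; the producers of that token on the BorelB road
(dag-n11-w1's faces B–E, p613848) need the run guard `hPC : PartCompat₁₃ θ P P.K` (their bg-facts editions H3 p626869 ∕ dag-n11-w3's member files trade it for the BG-ONEBLOCK supply),
and the binder «∀ window run, PartCompat» is unsatisfiable (p615408).  The node statement, however,
HAS the guard's run letter among its own antecedents: `Dag.B14_main ℓ` assumes `smallCouplings` (the window) and `(smallCouplings → flowControl)` ([III] (2.6)), and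
`…N11RunGuardOfFlowControl` shows these two give `PartCompat₁₃ θ P n` for all `n ≤ K` from the TOP divisibility `L^K·M·R_K(g_K) ∣ 2L^{m+K}` alone (or from the floor
`log(1∕g_K² + β⁺) ≤ L^{m−a}`).  THIS FILE threads that through the node: N11's node holds at EVERY run whose top cube fits, with the chain asked only on COMPATIBLE window runs
(`hN : window → PartCompat₁₃ θ p p.K → SupplyChainAt θ p` — the satisfiable direction: a supplier may ASSUME compatibility), and NO β-leaf, NO (0.31), NO Thm-2 leaf.  In [I] Thm 2's
regime (the leaf `thm2Regime`: `g_K = w.gR`) the per-run divisibility is the world-level scalar `M·R_K(w.gR) ∣ 2L^m` (§3; dag-n11-w1 g3's located item (n2) «N11's node face above the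
world-level floor», here with the guard from (2.6) instead of the `running` leaf of p620293).  The runs whose top cube does NOT fit are BG-ONEBLOCK's (p624439 §1–§2, dag-n11-w5) —
this file says nothing about them.

WHAT THIS FILE PROVES (0 `sorry`, 0 `def`; standard axioms; compositions BY NAME).
§1 SepCoPH-keyed (the K1 v9 record class binds `w.C = (datumOfRecord₁₃SepCoPH θ h).C`): ★★★ `b14_main_leavesP_of_supplyChainAt_of_compatible_of_topDvd` · ★★
   `b14_main_leavesP_of_supplyChainAt_of_compatible_of_floor` · ★★ `b14_main_leavesP_all_of_supplyChainAt_of_compatible_of_topDvd` (the ∀-run packaging: every run whose top cube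
   fits) · CoPH-keyed twin `b14_main_leavesP_datumOfRecord₁₃CoPH_of_supplyChainAt_of_compatible_of_topDvd` (dag-n11-d's binding).
§2 [I] Thm 2's regime: ★★ `topDvd_of_thm2Regime_of_mul_dvd` (`g_K = w.gR` ⇒ the top divisibility is the world scalar) · ★★★ `b14_main_leavesP_of_thm2Regime_of_supplyChainAt_of_compatible`
   · `b14_main_leavesP_all_of_thm2Regime_of_supplyChainAt_of_compatible` (every Thm-2-regime run, ONE world-level divisibility `M·R_K(w.gR) ∣ 2L^m`).
§3 (v1.1, APPEND-ONLY) ★★★ `b14_main_leavesP_all_of_twoSuppliers` (N11's node at EVERY run — the `∀ P` shape of K1 v9's rung-1 conjunct — from a COMPATIBLE-half supplier `window →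
   PartCompat₁₃ → SupplyChainAt` and a ONE-BLOCK-half supplier `window → ¬(top cube ∣ torus) → SupplyChainAt`, the dichotomy decided per run and the guard produced inside the node) ·
   `b14_main_leavesP_all_of_twoSuppliers'` (one-block half keyed on `1 ≤ K → ¬PartCompat₁₃`; pure case split) · ★★★ `b14_main_leavesP_all_of_twoSuppliers_split` (the hard half is
   TOLD the split point: a last compatible level `n₀ < K` with `PartCompat₁₃ θ p n₀` and every later level one-block — `…CompatibleInitialSegmentSplit`).

HONEST FRAMING.  Helper lane of K1⁹; count-neutral kernel composition of landed theorems; `SupplyChainAt θ p` ([III] §3's supplier obligations + the no-expansion obligation — XL,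
nobody's theorem), the window, (2.6), the top divisibility ∕ floor ∕ world scalar, the Thm-2 leaf are HYPOTHESES, inhabited at no θ here; nothing of Bałaban asserted; N11 NOT
discharged; K1⁹ NOT closed, no registered stub of v9 touched; counts unmoved (typed 28∕28 · discharged 5∕27 · A 5∕28).  One finite `𝕋⁴_{L^K}` programme at fixed `ε = L^{−K}`; R4
closes only the conditional finite-𝕋⁴ rung `BalabanLadder.UV` — NOT ℝ⁴, NOT OS, NOT a mass gap, NOT Clay.  No `sorry`, `axiom`, `def`, `instance`, `notation`.
Sources (SHAPE ∕ bookkeeping only): [III] Thm 1 p.262, Theorem p.245, p.244 L36–38, (2.6) p.255, (2.1) p.254, (2.5) p.255, p.257; [I] Thm 1 p.259, Thm 2 p.259, (0.1) p.251; [IV] (0.3)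
p.176, p.177 (i)–(ii).
-/

noncomputable section

namespace Summit.QuantumFields.YangMills.Theorems.BalabanUVNodesN11NodeFaceOfCompatibleSupplyChain

open Literature.MathematicalPhysics.QuantumFieldTheory.Balaban1983to89 T4Continuum Node00 DagBinding
open Literature.MathematicalPhysics.QuantumFieldTheory.Balaban1983to89.B16RLeafRecord13SepCoPH (b14_main_at_record₁₃SepCoPH_of_liveSel)
open Literature.MathematicalPhysics.QuantumFieldTheory.Balaban1983to89.B16RLeafRecord13LiveCoPH (b14_main_at_record₁₃CoPH_of_rOpLeaf rOpLeaf_VOfRecord₁₃CoPH_of_liveSel_of_rstep)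
open BalabanUVNodesN11Sect3SupplyChainObligationsDefs (SupplyChainAt thmP245Laws_of_supplyChainAt)
open BalabanUVNodesN11RunGuardOfFlowControl (partCompat₁₃_of_smallCouplings_of_flowControl_of_topDvd partCompat₁₃_of_smallCouplings_of_flowControl_of_floor)
open BalabanUVNodesN11CompatibleInitialSegmentSplit (exists_lastCompatibleLevel_of_smallCouplings_of_flowControl)
open BalabanUVNodesN11RunGuardIsTopCube (dCubeSide_dvd_iff_mul_dvd)
open BalabanUVNodesN11PartCompatOfCouplings (sitesPerDir_zero_eq)

variable {F : T4Family} {N : ℕ} [NeZero N]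

/-- `1 ≤ M` at a power-of-`L` basic cube `M = L^a`. [cite: Balaban1988Convergent, (2.1) p.254 (bookkeeping)] -/
private theorem one_le_M_of_powM {θ : Stage13HParams F N} {a : ℕ} (hMa : θ.τ9.M = F.L ^ a) : 1 ≤ θ.τ9.M := by
  rw [hMa]; exact Nat.one_le_pow _ _ (by have := F.hL11; omega)

/-! ## §1  N11's node on every run whose top cube fits, the chain asked only on COMPATIBLE window runs — guard from the node's own antecedents -/

section SepCoPH

variable {θ : Stage13HParams F N}

/-- **★★★ N11's NODE `Dag.B14_main (leavesP w p)` ON A RUN WHOSE TOP 𝐃_K-CUBE FITS, THE CHAIN ASKED ONLY ON COMPATIBLE WINDOW RUNS** (world bound to the SepCoPH datum of `θ` on the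
live-selector line; `M = L^a`, `r = 1`, `0 ≤ w.βup`, `w.βup·w.γ² ≤ 1`): if the run `p` lies in the world's window `]0, w.γ]` AND is partition-compatible at full length, N11's one-token
residual `SupplyChainAt θ p` gives the (S1ᵀ) slot (`thmP245Laws_of_supplyChainAt`); the compatibility is PRODUCED inside the node from its antecedents `smallCouplings` + `flowControl`
([III] (2.6)) and the top divisibility (`…RunGuardOfFlowControl.partCompat₁₃_of_smallCouplings_of_flowControl_of_topDvd`); the 𝐑-antecedent is read through the leaf.
[cite: Balaban1988Convergent, Thm 1 p.262, Theorem p.245, p.244 L36–38, (2.6) p.255, p.257; Balaban1989LargeFieldI, (0.3) p.176, p.177 (i)–(ii)] -/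
theorem b14_main_leavesP_of_supplyChainAt_of_compatible_of_topDvd (h : θ.Provisos₁₃SepCoPH F N)
    (hsel : θ.ppSel = ppSelLiveOfRecord F N θ.ν θ.τ9 (EOfRecord₁₃ F N θ.toStage13Params) (wOfRecord₉ F N θ.toStage9Params))
    (hθ : θ.Admissible F N) (hκ : 0 ≤ θ.s2.lf.κ) (hE₀ : 0 ≤ θ.s2.lf.E₀) (hB₀ : 0 ≤ θ.s2.lf.B₀)
    {a : ℕ} (hMa : θ.τ9.M = F.L ^ a) (hr : θ.ν.r = 1)
    (w : WorldP) (hC : w.C = (datumOfRecord₁₃SepCoPH F N θ h).C) (hβ : 0 ≤ w.βup) (hβγ : w.βup * w.γ ^ 2 ≤ 1) (p : B12.RunParams)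
    (htop : dCubeSide (F.P p.K).L θ.τ9.M (RkOfRecord (F.P p.K).L θ.ν.r (gOfRecord₁₃ F N θ.toStage13Params p p.K)) p.K ∣ (F.P p.K).sitesPerDir 0)
    (hN : Step.InInterval w.γ p.K (gOfRecord₁₃ F N θ.toStage13Params p) → PartCompat₁₃ F N θ.toStage13Params p p.K → SupplyChainAt θ p) :
    Dag.B14_main (leavesP w p) :=
  b14_main_at_record₁₃SepCoPH_of_liveSel F N θ p w h hC hθ hκ hE₀ hB₀ hsel fun _ _ _ _ _ hsc _ hfc =>
    thmP245Laws_of_supplyChainAt h.toCore hsel hθ hκ hE₀ hB₀ (one_le_M_of_powM hMa)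
      (hN (by have h' : Step.InInterval w.γ p.K (w.C p).flow.g := hsc; rwa [hC] at h')
        (partCompat₁₃_of_smallCouplings_of_flowControl_of_topDvd θ.toStage13Params hMa hr w hβ hβγ p (by rw [hC]; rfl) hsc hfc htop le_rfl))

/-- **★★ THE SAME ABOVE THE FLOOR** (`a ≤ m`, `0 ≤ w.βup`; no `βup·γ² ≤ 1`): on a run whose LAST coupling clears `log(1∕g_K² + w.βup) ≤ L^{m−a}`, N11's node from the chain on
compatible window runs. [cite: Balaban1988Convergent, Thm 1 p.262, Theorem p.245, (2.6) p.255, p.257; Balaban1987RG1, (0.31) p.259] -/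
theorem b14_main_leavesP_of_supplyChainAt_of_compatible_of_floor (h : θ.Provisos₁₃SepCoPH F N)
    (hsel : θ.ppSel = ppSelLiveOfRecord F N θ.ν θ.τ9 (EOfRecord₁₃ F N θ.toStage13Params) (wOfRecord₉ F N θ.toStage9Params))
    (hθ : θ.Admissible F N) (hκ : 0 ≤ θ.s2.lf.κ) (hE₀ : 0 ≤ θ.s2.lf.E₀) (hB₀ : 0 ≤ θ.s2.lf.B₀)
    {a : ℕ} (hMa : θ.τ9.M = F.L ^ a) (hr : θ.ν.r = 1) (ha : a ≤ F.m)
    (w : WorldP) (hC : w.C = (datumOfRecord₁₃SepCoPH F N θ h).C) (hβ : 0 ≤ w.βup) (p : B12.RunParams)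
    (hfloor : Real.log (1 / gOfRecord₁₃ F N θ.toStage13Params p p.K ^ 2 + w.βup) ≤ ((F.L ^ (F.m - a) : ℕ) : ℝ))
    (hN : Step.InInterval w.γ p.K (gOfRecord₁₃ F N θ.toStage13Params p) → PartCompat₁₃ F N θ.toStage13Params p p.K → SupplyChainAt θ p) :
    Dag.B14_main (leavesP w p) :=
  b14_main_at_record₁₃SepCoPH_of_liveSel F N θ p w h hC hθ hκ hE₀ hB₀ hsel fun _ _ _ _ _ hsc _ hfc =>
    thmP245Laws_of_supplyChainAt h.toCore hsel hθ hκ hE₀ hB₀ (one_le_M_of_powM hMa)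
      (hN (by have h' : Step.InInterval w.γ p.K (w.C p).flow.g := hsc; rwa [hC] at h')
        (partCompat₁₃_of_smallCouplings_of_flowControl_of_floor θ.toStage13Params hMa hr ha w hβ p (by rw [hC]; rfl) hsc hfc hfloor le_rfl))

/-- **★★ THE ∀-RUN PACKAGING: N11's NODE ON EVERY RUN WHOSE TOP CUBE FITS**, the chain asked only on compatible window runs (`∀ p, window → PartCompat₁₃ θ p p.K → SupplyChainAt θ p` —
a supplier may ASSUME compatibility); the complement (window runs whose top cube does not fit) is BG-ONEBLOCK's and is not claimed. [cite: Balaban1988Convergent, Thm 1 p.262, Theorem p.245, (2.6) p.255, p.257] -/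
theorem b14_main_leavesP_all_of_supplyChainAt_of_compatible_of_topDvd (h : θ.Provisos₁₃SepCoPH F N)
    (hsel : θ.ppSel = ppSelLiveOfRecord F N θ.ν θ.τ9 (EOfRecord₁₃ F N θ.toStage13Params) (wOfRecord₉ F N θ.toStage9Params))
    (hθ : θ.Admissible F N) (hκ : 0 ≤ θ.s2.lf.κ) (hE₀ : 0 ≤ θ.s2.lf.E₀) (hB₀ : 0 ≤ θ.s2.lf.B₀)
    {a : ℕ} (hMa : θ.τ9.M = F.L ^ a) (hr : θ.ν.r = 1)
    (w : WorldP) (hC : w.C = (datumOfRecord₁₃SepCoPH F N θ h).C) (hβ : 0 ≤ w.βup) (hβγ : w.βup * w.γ ^ 2 ≤ 1)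
    (hN : ∀ p : B12.RunParams, Step.InInterval w.γ p.K (gOfRecord₁₃ F N θ.toStage13Params p) → PartCompat₁₃ F N θ.toStage13Params p p.K → SupplyChainAt θ p) :
    ∀ p : B12.RunParams,
      dCubeSide (F.P p.K).L θ.τ9.M (RkOfRecord (F.P p.K).L θ.ν.r (gOfRecord₁₃ F N θ.toStage13Params p p.K)) p.K ∣ (F.P p.K).sitesPerDir 0 →
        Dag.B14_main (leavesP w p) := fun p htop =>
  b14_main_leavesP_of_supplyChainAt_of_compatible_of_topDvd h hsel hθ hκ hE₀ hB₀ hMa hr w hC hβ hβγ p htop (hN p)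

end SepCoPH

section CoPH

variable {θ : Stage13HParams F N}

/-- **CoPH-KEYED TWIN** (dag-n11-d's binding `w.C = (datumOfRecord₁₃CoPH θ h).C`, `h : θ.Provisos₁₃CoPH`): N11's node on a run whose top cube fits, the chain asked only on compatible
window runs; guard from the node's own `smallCouplings` + `flowControl`. [cite: Balaban1988Convergent, Thm 1 p.262, Theorem p.245, p.244 L36–38, (2.6) p.255, p.257; Balaban1989LargeFieldI, (0.3) p.176] -/
theorem b14_main_leavesP_datumOfRecord₁₃CoPH_of_supplyChainAt_of_compatible_of_topDvd (h : θ.Provisos₁₃CoPH F N)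
    (hsel : θ.ppSel = ppSelLiveOfRecord F N θ.ν θ.τ9 (EOfRecord₁₃ F N θ.toStage13Params) (wOfRecord₉ F N θ.toStage9Params))
    (hθ : θ.Admissible F N) (hκ : 0 ≤ θ.s2.lf.κ) (hE₀ : 0 ≤ θ.s2.lf.E₀) (hB₀ : 0 ≤ θ.s2.lf.B₀)
    {a : ℕ} (hMa : θ.τ9.M = F.L ^ a) (hr : θ.ν.r = 1)
    (w : WorldP) (hC : w.C = (datumOfRecord₁₃CoPH F N θ h).C) (hβ : 0 ≤ w.βup) (hβγ : w.βup * w.γ ^ 2 ≤ 1) (p : B12.RunParams)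
    (htop : dCubeSide (F.P p.K).L θ.τ9.M (RkOfRecord (F.P p.K).L θ.ν.r (gOfRecord₁₃ F N θ.toStage13Params p p.K)) p.K ∣ (F.P p.K).sitesPerDir 0)
    (hN : Step.InInterval w.γ p.K (gOfRecord₁₃ F N θ.toStage13Params p) → PartCompat₁₃ F N θ.toStage13Params p p.K → SupplyChainAt θ p) :
    Dag.B14_main (leavesP w p) :=
  b14_main_at_record₁₃CoPH_of_rOpLeaf F N θ p w h hC
    (fun _ => rOpLeaf_VOfRecord₁₃CoPH_of_liveSel_of_rstep F N θ p (fun q j _ hj => h.rstep q j hj) hθ hκ hE₀ hB₀ hsel)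
    fun _ _ _ _ _ hsc _ hfc =>
      thmP245Laws_of_supplyChainAt h hsel hθ hκ hE₀ hB₀ (one_le_M_of_powM hMa)
        (hN (by have h' : Step.InInterval w.γ p.K (w.C p).flow.g := hsc; rwa [hC] at h')
          (partCompat₁₃_of_smallCouplings_of_flowControl_of_topDvd θ.toStage13Params hMa hr w hβ hβγ p (by rw [hC]; rfl) hsc hfc htop le_rfl))

end CoPH

/-! ## §2  In [I] Thm 2's regime (`g_K = w.gR`) the per-run divisibility is one world-level scalar -/

section Thm2Regime

variable {θ : Stage13HParams F N}

/-- **★★ IN THM 2's REGIME THE TOP DIVISIBILITY IS A WORLD SCALAR**: at a world bound to the SepCoPH datum, if the run `p` is in the `thm2Regime` leaf (`g_K = w.gR`), then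
`L^K·M·R_K(g_K) ∣ 2L^{m+K}` is the world-level divisibility `M·R_K(w.gR) ∣ 2L^m` — the physical torus contains one top-scale 𝐃-cube at the RENORMALISED coupling.
[cite: Balaban1987RG1, Thm 2 p.259 (`g_K = g`), (0.1) p.251; Balaban1988Convergent, (2.1) p.254, (2.5) p.255, p.257] -/
theorem topDvd_of_thm2Regime_of_mul_dvd (h : θ.Provisos₁₃SepCoPH F N) (w : WorldP) (hC : w.C = (datumOfRecord₁₃SepCoPH F N θ h).C) (p : B12.RunParams)
    (hreg : (leavesP w p).thm2Regime) (hdvd : θ.τ9.M * RkOfRecord F.L θ.ν.r w.gR ∣ 2 * F.L ^ F.m) :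
    dCubeSide (F.P p.K).L θ.τ9.M (RkOfRecord (F.P p.K).L θ.ν.r (gOfRecord₁₃ F N θ.toStage13Params p p.K)) p.K ∣ (F.P p.K).sitesPerDir 0 := by
  obtain ⟨-, -, hK, -⟩ := hreg
  have hgK : gOfRecord₁₃ F N θ.toStage13Params p p.K = w.gR := by
    have h' : (w.C p).flow.g p.K = w.gR := hK
    rwa [hC] at h'
  rw [sitesPerDir_zero_eq]
  simp only [T4Family.P_L]
  rw [hgK, dCubeSide_dvd_iff_mul_dvd (by have := F.hL11; omega)]
  exact hdvd

/-- **★★★ N11's NODE ON A THM-2-REGIME RUN, THE CHAIN ASKED ONLY ON COMPATIBLE WINDOW RUNS — ONE WORLD-LEVEL DIVISIBILITY** (`M = L^a`, `r = 1`, `0 ≤ w.βup`, `w.βup·w.γ² ≤ 1`,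
`M·R_K(w.gR) ∣ 2L^m`): dag-n11-w1 g3's located item (n2) «N11's node face above the world-level floor», with the guard from the node's own (2.6) antecedent.  The Thm-2 leaf is an
extra HYPOTHESIS on the run (it is not an antecedent of `Dag.B14_main`). [cite: Balaban1987RG1, Thm 2 p.259; Balaban1988Convergent, Thm 1 p.262, Theorem p.245, (2.6) p.255, p.257] -/
theorem b14_main_leavesP_of_thm2Regime_of_supplyChainAt_of_compatible (h : θ.Provisos₁₃SepCoPH F N)
    (hsel : θ.ppSel = ppSelLiveOfRecord F N θ.ν θ.τ9 (EOfRecord₁₃ F N θ.toStage13Params) (wOfRecord₉ F N θ.toStage9Params))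
    (hθ : θ.Admissible F N) (hκ : 0 ≤ θ.s2.lf.κ) (hE₀ : 0 ≤ θ.s2.lf.E₀) (hB₀ : 0 ≤ θ.s2.lf.B₀)
    {a : ℕ} (hMa : θ.τ9.M = F.L ^ a) (hr : θ.ν.r = 1)
    (w : WorldP) (hC : w.C = (datumOfRecord₁₃SepCoPH F N θ h).C) (hβ : 0 ≤ w.βup) (hβγ : w.βup * w.γ ^ 2 ≤ 1)
    (hdvd : θ.τ9.M * RkOfRecord F.L θ.ν.r w.gR ∣ 2 * F.L ^ F.m) (p : B12.RunParams) (hreg : (leavesP w p).thm2Regime)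
    (hN : Step.InInterval w.γ p.K (gOfRecord₁₃ F N θ.toStage13Params p) → PartCompat₁₃ F N θ.toStage13Params p p.K → SupplyChainAt θ p) :
    Dag.B14_main (leavesP w p) :=
  b14_main_leavesP_of_supplyChainAt_of_compatible_of_topDvd h hsel hθ hκ hE₀ hB₀ hMa hr w hC hβ hβγ p
    (topDvd_of_thm2Regime_of_mul_dvd h w hC p hreg hdvd) hN

/-- **★★ THE ∀-RUN PACKAGING IN THM 2's REGIME**: N11's node on EVERY Thm-2-regime run of the world, from the chain on compatible window runs and ONE world-level divisibility
`M·R_K(w.gR) ∣ 2L^m`. [cite: Balaban1987RG1, Thm 2 p.259; Balaban1988Convergent, Thm 1 p.262, Theorem p.245, (2.6) p.255, p.257] -/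
theorem b14_main_leavesP_all_of_thm2Regime_of_supplyChainAt_of_compatible (h : θ.Provisos₁₃SepCoPH F N)
    (hsel : θ.ppSel = ppSelLiveOfRecord F N θ.ν θ.τ9 (EOfRecord₁₃ F N θ.toStage13Params) (wOfRecord₉ F N θ.toStage9Params))
    (hθ : θ.Admissible F N) (hκ : 0 ≤ θ.s2.lf.κ) (hE₀ : 0 ≤ θ.s2.lf.E₀) (hB₀ : 0 ≤ θ.s2.lf.B₀)
    {a : ℕ} (hMa : θ.τ9.M = F.L ^ a) (hr : θ.ν.r = 1)
    (w : WorldP) (hC : w.C = (datumOfRecord₁₃SepCoPH F N θ h).C) (hβ : 0 ≤ w.βup) (hβγ : w.βup * w.γ ^ 2 ≤ 1)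
    (hdvd : θ.τ9.M * RkOfRecord F.L θ.ν.r w.gR ∣ 2 * F.L ^ F.m)
    (hN : ∀ p : B12.RunParams, Step.InInterval w.γ p.K (gOfRecord₁₃ F N θ.toStage13Params p) → PartCompat₁₃ F N θ.toStage13Params p p.K → SupplyChainAt θ p) :
    ∀ p : B12.RunParams, (leavesP w p).thm2Regime → Dag.B14_main (leavesP w p) := fun p hreg =>
  b14_main_leavesP_of_thm2Regime_of_supplyChainAt_of_compatible h hsel hθ hκ hE₀ hB₀ hMa hr w hC hβ hβγ hdvd p hreg (hN p)

end Thm2Regime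

/-! ## §3  (v1.1, APPEND-ONLY) N11's node at EVERY run from TWO half-suppliers — the case split done INSIDE the node by (2.6) -/

section TwoSuppliers

variable {θ : Stage13HParams F N}

/-- **★★★ N11's NODE CONJUNCT `∀ P, Dag.B14_main (leavesP w P)` FROM THE TWO HALVES** (world bound to the SepCoPH datum on the live-selector line; `M = L^a`, `r = 1`, `0 ≤ w.βup`,
`w.βup·w.γ² ≤ 1`): a COMPATIBLE-half supplier `hNc : window → PartCompat₁₃ θ p p.K → SupplyChainAt θ p` (the BorelB ∕ chain roads with `hPC`) and a ONE-BLOCK-half supplier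
`hN1 : window → ¬(top 𝐃_K-cube ∣ torus) → SupplyChainAt θ p` (BG-ONEBLOCK's territory: the runs with a one-block tail, `…CompatibleInitialSegmentSplit`) give N11's node at EVERY run —
the dichotomy «top cube fits or not» is decided per run and, when it fits, the guard is produced inside the node from `smallCouplings` + `flowControl` (p630366 §3).  This is the `∀ P` shape
of the K1 v9 rung-1 conjunct `Nodes (leavesP w P)` for N11; nothing is claimed about either supplier. [cite: Balaban1988Convergent, Thm 1 p.262, Theorem p.245, (2.6) p.255, p.257; Balaban1989LargeFieldI, (0.3) p.176] -/
theorem b14_main_leavesP_all_of_twoSuppliers (h : θ.Provisos₁₃SepCoPH F N)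
    (hsel : θ.ppSel = ppSelLiveOfRecord F N θ.ν θ.τ9 (EOfRecord₁₃ F N θ.toStage13Params) (wOfRecord₉ F N θ.toStage9Params))
    (hθ : θ.Admissible F N) (hκ : 0 ≤ θ.s2.lf.κ) (hE₀ : 0 ≤ θ.s2.lf.E₀) (hB₀ : 0 ≤ θ.s2.lf.B₀)
    {a : ℕ} (hMa : θ.τ9.M = F.L ^ a) (hr : θ.ν.r = 1)
    (w : WorldP) (hC : w.C = (datumOfRecord₁₃SepCoPH F N θ h).C) (hβ : 0 ≤ w.βup) (hβγ : w.βup * w.γ ^ 2 ≤ 1)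
    (hNc : ∀ p : B12.RunParams, Step.InInterval w.γ p.K (gOfRecord₁₃ F N θ.toStage13Params p) → PartCompat₁₃ F N θ.toStage13Params p p.K → SupplyChainAt θ p)
    (hN1 : ∀ p : B12.RunParams, Step.InInterval w.γ p.K (gOfRecord₁₃ F N θ.toStage13Params p) →
      ¬ dCubeSide (F.P p.K).L θ.τ9.M (RkOfRecord (F.P p.K).L θ.ν.r (gOfRecord₁₃ F N θ.toStage13Params p p.K)) p.K ∣ (F.P p.K).sitesPerDir 0 → SupplyChainAt θ p) :
    ∀ p : B12.RunParams, Dag.B14_main (leavesP w p) := fun p =>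
  b14_main_at_record₁₃SepCoPH_of_liveSel F N θ p w h hC hθ hκ hE₀ hB₀ hsel fun _ _ _ _ _ hsc _ hfc =>
    thmP245Laws_of_supplyChainAt h.toCore hsel hθ hκ hE₀ hB₀ (one_le_M_of_powM hMa) (by
      have hW : Step.InInterval w.γ p.K (gOfRecord₁₃ F N θ.toStage13Params p) := by
        have h' : Step.InInterval w.γ p.K (w.C p).flow.g := hsc
        rwa [hC] at h'
      by_cases htop : dCubeSide (F.P p.K).L θ.τ9.M (RkOfRecord (F.P p.K).L θ.ν.r (gOfRecord₁₃ F N θ.toStage13Params p p.K)) p.K ∣ (F.P p.K).sitesPerDir 0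
      · exact hNc p hW (partCompat₁₃_of_smallCouplings_of_flowControl_of_topDvd θ.toStage13Params hMa hr w hβ hβγ p (by rw [hC]; rfl) hsc hfc htop le_rfl)
      · exact hN1 p hW htop)

/-- **★★ THE SAME WITH THE ONE-BLOCK HALF KEYED ON THE GUARD's FAILURE** (`1 ≤ p.K → ¬ PartCompat₁₃ θ p p.K`, the currency of p617030 ∕ p621363's incompatible runs): under the node's
antecedents the two keys agree (p630366 `partCompat₁₃_top_iff_topDvd_of_smallCouplings_of_flowControl`); a run with `K = 0` is compatible vacuously.  This edition is a pure
case split on the guard — it needs neither (2.6) nor `r = 1` nor the world scalars (only `M = L^a` for `1 ≤ M`). [cite: Balaban1988Convergent, Thm 1 p.262, p.257] -/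
theorem b14_main_leavesP_all_of_twoSuppliers' (h : θ.Provisos₁₃SepCoPH F N)
    (hsel : θ.ppSel = ppSelLiveOfRecord F N θ.ν θ.τ9 (EOfRecord₁₃ F N θ.toStage13Params) (wOfRecord₉ F N θ.toStage9Params))
    (hθ : θ.Admissible F N) (hκ : 0 ≤ θ.s2.lf.κ) (hE₀ : 0 ≤ θ.s2.lf.E₀) (hB₀ : 0 ≤ θ.s2.lf.B₀)
    {a : ℕ} (hMa : θ.τ9.M = F.L ^ a)
    (w : WorldP) (hC : w.C = (datumOfRecord₁₃SepCoPH F N θ h).C)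
    (hNc : ∀ p : B12.RunParams, Step.InInterval w.γ p.K (gOfRecord₁₃ F N θ.toStage13Params p) → PartCompat₁₃ F N θ.toStage13Params p p.K → SupplyChainAt θ p)
    (hN1 : ∀ p : B12.RunParams, Step.InInterval w.γ p.K (gOfRecord₁₃ F N θ.toStage13Params p) → 1 ≤ p.K → ¬ PartCompat₁₃ F N θ.toStage13Params p p.K → SupplyChainAt θ p) :
    ∀ p : B12.RunParams, Dag.B14_main (leavesP w p) := fun p =>
  b14_main_at_record₁₃SepCoPH_of_liveSel F N θ p w h hC hθ hκ hE₀ hB₀ hsel fun _ _ _ _ _ hsc _ _ =>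
    thmP245Laws_of_supplyChainAt h.toCore hsel hθ hκ hE₀ hB₀ (one_le_M_of_powM hMa) (by
      have hW : Step.InInterval w.γ p.K (gOfRecord₁₃ F N θ.toStage13Params p) := by
        have h' : Step.InInterval w.γ p.K (w.C p).flow.g := hsc
        rwa [hC] at h'
      by_cases hPC : PartCompat₁₃ F N θ.toStage13Params p p.K
      · exact hNc p hW hPC
      · have hK : 1 ≤ p.K := by
          by_contra h0
          exact hPC (by rw [show p.K = 0 by omega]; exact partCompat₁₃_zero F N θ.toStage13Params p)
        exact hN1 p hW hK hPC)

/-- **★★★ THE SAME WITH THE HARD HALF TOLD WHERE PRINT's REGIME ENDS**: the one-block-half supplier receives the SPLIT POINT — a last compatible level `n₀ < K` with `PartCompat₁₃ θ p n₀`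
and every level `n₀ < n ≤ K` ONE-BLOCK (`…CompatibleInitialSegmentSplit.exists_lastCompatibleLevel_of_smallCouplings_of_flowControl`, from the node's own `smallCouplings` + `flowControl`) —
and the compatible-half supplier the full guard; together N11's node holds at EVERY run.  The interface BG-ONEBLOCK's chain-level induction wants: print's geometry up to `n₀`, the one-block
geometry (histories = staircases, `…OneBlockTailHistories`) after it. [cite: Balaban1988Convergent, Thm 1 p.262, Theorem p.245, (2.6) p.255, (2.1) p.254, p.257; Balaban1989LargeFieldI, (0.3) p.176] -/
theorem b14_main_leavesP_all_of_twoSuppliers_split (h : θ.Provisos₁₃SepCoPH F N)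
    (hsel : θ.ppSel = ppSelLiveOfRecord F N θ.ν θ.τ9 (EOfRecord₁₃ F N θ.toStage13Params) (wOfRecord₉ F N θ.toStage9Params))
    (hθ : θ.Admissible F N) (hκ : 0 ≤ θ.s2.lf.κ) (hE₀ : 0 ≤ θ.s2.lf.E₀) (hB₀ : 0 ≤ θ.s2.lf.B₀)
    {a : ℕ} (hMa : θ.τ9.M = F.L ^ a) (hr : θ.ν.r = 1)
    (w : WorldP) (hC : w.C = (datumOfRecord₁₃SepCoPH F N θ h).C) (hβ : 0 ≤ w.βup) (hβγ : w.βup * w.γ ^ 2 ≤ 1)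
    (hNc : ∀ p : B12.RunParams, Step.InInterval w.γ p.K (gOfRecord₁₃ F N θ.toStage13Params p) → PartCompat₁₃ F N θ.toStage13Params p p.K → SupplyChainAt θ p)
    (hN1 : ∀ p : B12.RunParams, Step.InInterval w.γ p.K (gOfRecord₁₃ F N θ.toStage13Params p) →
      ∀ n₀, n₀ < p.K → PartCompat₁₃ F N θ.toStage13Params p n₀ →
        (∀ n, n₀ < n → n ≤ p.K →
          (F.P p.K).sitesPerDir 0 < dCubeSide (F.P p.K).L θ.τ9.M (RkOfRecord (F.P p.K).L θ.ν.r (gOfRecord₁₃ F N θ.toStage13Params p n)) n) →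
        SupplyChainAt θ p) :
    ∀ p : B12.RunParams, Dag.B14_main (leavesP w p) := fun p =>
  b14_main_at_record₁₃SepCoPH_of_liveSel F N θ p w h hC hθ hκ hE₀ hB₀ hsel fun _ _ _ _ _ hsc _ hfc =>
    thmP245Laws_of_supplyChainAt h.toCore hsel hθ hκ hE₀ hB₀ (one_le_M_of_powM hMa) (by
      have hW : Step.InInterval w.γ p.K (gOfRecord₁₃ F N θ.toStage13Params p) := by
        have h' : Step.InInterval w.γ p.K (w.C p).flow.g := hsc
        rwa [hC] at h'
      obtain ⟨n₀, hn₀, hPC, htail⟩ :=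
        exists_lastCompatibleLevel_of_smallCouplings_of_flowControl θ.toStage13Params hMa hr w hβ hβγ p (by rw [hC]; rfl) hsc hfc
      rcases hn₀.eq_or_lt with h0 | hlt
      · exact hNc p hW (h0 ▸ hPC)
      · exact hN1 p hW n₀ hlt hPC htail)

end TwoSuppliers

end Summit.QuantumFields.YangMills.Theorems.BalabanUVNodesN11NodeFaceOfCompatibleSupplyChain

end
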